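import Summits.QuantumFields.YangMills.Theorems.AllWindowsColdBoxBulkMidPotentialCorollariesDefs
import Summits.QuantumFields.YangMills.Theorems.ColdBoxAllGroupsBulkAllGroupsCrudeGoodLargeFieldFlatG
import Summits.QuantumFields.YangMills.Theorems.AllWindowsColdBoxDirResponseL1OfDipoleDecay

/-!
# LINE-18 «BulkMidWindowSU2 birth v5» stub S4 `stub_potentialCorollaries`, BY NAME (crux `AllWindowsColdBox.BulkMidWindowSU2`, ⟨stmt-QuantumFields-24006⟩)

The registered bundle stub S4 of LINE-18 v5 (planner ym-idea-2 g14, skeleton sha16 `3c750a3750a2f49e`, critic idea-crit-4 PASS on v4/v5):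
`(DirKernelDipoleDecay → DirFreeVarLinear → DirResponseL1) ∧ (DirHarmonicMaxPrincipleFlux → KernelLargeFieldRarityFlatG)` — the two corollaries
K2 and R of the line's potential theory.

* Half 1 (K1 ⇒ K2, hypothesis C unused) is the tree's ✓`AllWindowsColdBox.DirResponse.dirResponseL1_of_dipoleDecay`
  (`…AllWindowsColdBoxDirResponseL1OfDipoleDecay`, both Props unfolded; `plaqDist` is definitionally the cast ℓ¹ distance).
* Half 2 (R) holds OUTRIGHT, without K3′: `kernelLargeFieldRarityFlatG_holds` is the `SU(2)`-fundamental instance of the G-generic flat-rate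
  bound ✓`ColdBoxAllGroups.boxKernelG_real_coldGoodSetG_compl_le_flat` (`…ColdBoxAllGroupsBulkAllGroupsCrudeGoodLargeFieldFlatG`): a crude-good
  datum bounds every plaquette touching the box, so the Laplace lower bound on `Z_Λ(ω)` may be taken around the datum's own restriction `ω|_Λ`
  (energy `≍ β^{4θ+2δ}`), and the window is `ε > 2θ + δ` for every `0 < θ`, `0 ≤ δ` (the side conditions `θ ≤ 1/16`, `δ ≤ θ` are not needed).

After this file the line's registered stubs S1 (`stub_boxDirichletDominationMidAbs`, file `…BulkMidDominationMidAbs`), S2 (`stub_flatTiltInputs`),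
S3 = K1, S4, S5 = K3′ are all landed; S6 (`stub_kernelMeanExpansionMidG`) and S7 (`stub_kernelCovExpansionMidG`) — the two second-order one-scale
expansions with datum at `θ ≤ 1/16` — remain OPEN.
HONEST LABEL: closes ONE registered stub of a critic-passed DRAFT line on the R2ξ″ RECORD-rung crux ⟨24006⟩ by name; no crux, rung or summit is
proved; the Yang–Mills mass gap is NOT proved by this file.
-/

set_option autoImplicit false

noncomputable section

open Literature.MathematicalPhysics.QuantumLattice (fundamentalRep fundamentalRep_mem_unitaryGroup continuous_fundamentalRep)
open Summit.QuantumFields.YangMills.Theorems.ColdBoxAllGroups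

namespace Summit.QuantumFields.YangMills.Theorems.AllWindowsColdBoxBulkMidLine

/-- **Obligation R of LINE-18 v5 holds** (flat-rate small-field rarity under the box kernel with a crude-good datum, `SU(2)` fundamental):
the instance `G = SU(2)`, `ρ =` fundamental of `ColdBoxAllGroups.boxKernelG_real_coldGoodSetG_compl_le_flat`. -/
theorem kernelLargeFieldRarityFlatG_holds : KernelLargeFieldRarityFlatG := by
  intro θ δ ε hθ _ hδ _ hε
  exact boxKernelG_real_coldGoodSetG_compl_le_flat (fundamentalRep (Fin 2)) fundamentalRep_mem_unitaryGroup
    (continuous_fundamentalRep (Fin 2)) hθ hδ hε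

/-- **Stub S4 of LINE-18 (`stub_potentialCorollaries`), BY NAME**: K1 ⇒ K2 (half 1, the tree's `dirResponseL1_of_dipoleDecay`; the hypothesis
`DirFreeVarLinear` is not used) and K3′ ⇒ R (half 2; R holds unconditionally, `kernelLargeFieldRarityFlatG_holds`). -/
theorem stub_potentialCorollaries :
    (DirKernelDipoleDecay → DirFreeVarLinear → DirResponseL1) ∧ (DirHarmonicMaxPrincipleFlux → KernelLargeFieldRarityFlatG) :=
  ⟨fun hK1 _ => AllWindowsColdBox.DirResponse.dirResponseL1_of_dipoleDecay hK1, fun _ => kernelLargeFieldRarityFlatG_holds⟩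

end Summit.QuantumFields.YangMills.Theorems.AllWindowsColdBoxBulkMidLine

end
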